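/-
Copyright (c) 2026. All rights reserved.
Released under Apache 2.0 license as described in the file LICENSE.
-/
import Mathlib
import Literature.Analysis.FunctionSpaces.PlancherelL1L2
import HarnessLib

/-!
# Towards L-EL, Step 3b: the band-limited Fubini identity

`HANDOFF/prove-1` gen15, ATTEMPT-22 §6 (S22-d) / idea-1 IDEAS-prolate §131.3 «L-EL», companion of
`HandoffSlavedELSteps` (polarised Plancherel = Step 3a, Steps 1, 4; Step 2 is the tree's
`DiscreteRect.eq_zero_of_forall_le_add_quad`). Here, for `F, k ∈ L¹(ℝ)`:

  `∫_{|ξ|<λ} conj(𝓕F ξ)·𝓕k ξ dξ = ∫ conj(𝓕⁻(1_{|ξ|<λ}·𝓕F) x)·k x dx`   (`integral_band_conj_fourier_mul_eq`)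

i.e. the band part of the polarised Plancherel pairing is the `x`-side pairing against the
BAND-LIMITED function `D_λF = 𝓕⁻(1_{|ξ|<λ}·𝓕F)` (a genuine Bochner integral: the band piece is `L¹`,
`integrable_band_fourier`). Ingredients: Mathlib's self-adjointness
`VectorFourier.integral_fourierIntegral_smul_eq_flip` and `𝓕(conj∘h) = conj∘𝓕⁻h`
(`fourier_conj_eq_conj_fourierInv`). With Step 3a this gives Step 3 of L-EL:
`∫_{|ξ|≥λ} conj(𝓕F)𝓕k = ∫ conj(F − D_λF)·k`. RH-free; nothing here bears on the truth of RH.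
-/

set_option linter.dupNamespace false

noncomputable section

open MeasureTheory Set Complex
open scoped FourierTransform

namespace Summit.RiemannHypothesis.RiemannHypothesis.Theorems

namespace LatticeUncertainty.SlavedEL

/-- `𝓕 (conj ∘ h) = conj ∘ 𝓕⁻ h` pointwise. -/
theorem fourier_conj_eq_conj_fourierInv (h : ℝ → ℂ) (x : ℝ) :
    𝓕 (fun v ↦ starRingEnd ℂ (h v)) x = starRingEnd ℂ (𝓕⁻ h x) := by
  rw [Real.fourier_eq, Real.fourierInv_eq, ← integral_conj]
  refine integral_congr_ae (ae_of_all _ fun v ↦ ?_)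
  simp only [Circle.smul_def, smul_eq_mul, map_mul]
  congr 1
  rw [← Circle.coe_inv_eq_conj, ← AddChar.map_neg_eq_inv]

/-- The band-limited piece `1_{|ξ|<λ}·𝓕F` is integrable (`𝓕F` is continuous and bounded). -/
theorem integrable_band_fourier {F : ℝ → ℂ} (hF : Integrable F) (lam : ℝ) :
    Integrable ({ξ : ℝ | |ξ| < lam}.indicator (𝓕 F)) := by
  have hB : MeasurableSet {ξ : ℝ | |ξ| < lam} :=
    measurableSet_lt (continuous_abs.measurable) measurable_const
  rw [integrable_indicator_iff hB]
  have hc : Continuous (𝓕 F) := Literature.Analysis.FunctionSpaces.continuous_fourierIntegral hF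
  have hsub : {ξ : ℝ | |ξ| < lam} ⊆ Icc (-lam) lam := fun ξ hξ ↦ by
    simp only [mem_setOf_eq, abs_lt] at hξ; exact ⟨hξ.1.le, hξ.2.le⟩
  exact (hc.continuousOn.integrableOn_compact isCompact_Icc).mono_set hsub

/-- **Step 3b of L-EL (band-limited Fubini).**
`∫_{|ξ|<λ} conj(𝓕F ξ)·𝓕k ξ dξ = ∫ conj(𝓕⁻(1_{|ξ|<λ}·𝓕F) x)·k x dx` for `F, k ∈ L¹`. -/
theorem integral_band_conj_fourier_mul_eq {F k : ℝ → ℂ} (hF : Integrable F) (hk : Integrable k)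
    (lam : ℝ) :
    ∫ ξ in {ξ : ℝ | |ξ| < lam}, starRingEnd ℂ (𝓕 F ξ) * 𝓕 k ξ =
      ∫ x, starRingEnd ℂ (𝓕⁻ ({ξ : ℝ | |ξ| < lam}.indicator (𝓕 F)) x) * k x := by
  set B : Set ℝ := {ξ : ℝ | |ξ| < lam} with hBdef
  have hB : MeasurableSet B := measurableSet_lt (continuous_abs.measurable) measurable_const
  set h : ℝ → ℂ := B.indicator (𝓕 F) with hh
  have hhi : Integrable h := integrable_band_fourier hF lam
  have hci : Integrable (fun v ↦ starRingEnd ℂ (h v)) := by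
    refine Integrable.mono' hhi.norm
      (Complex.continuous_conj.comp_aestronglyMeasurable hhi.aestronglyMeasurable)
      (ae_of_all _ fun v ↦ by rw [Complex.norm_conj])
  -- (1) the set integral as a whole-line integral against `conj h`
  have e1 : ∫ ξ in B, starRingEnd ℂ (𝓕 F ξ) * 𝓕 k ξ = ∫ ξ, starRingEnd ℂ (h ξ) * 𝓕 k ξ := by
    rw [← integral_indicator hB]
    refine integral_congr_ae (ae_of_all _ fun ξ ↦ ?_)
    simp only
    by_cases hξ : ξ ∈ B
    · rw [indicator_of_mem hξ, hh, indicator_of_mem hξ]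
    · rw [indicator_of_notMem hξ, hh, indicator_of_notMem hξ, map_zero, zero_mul]
  -- (2) self-adjointness of `𝓕` (Mathlib): `∫ 𝓕(conj h)·k = ∫ conj h · 𝓕 k`
  have e2 := VectorFourier.integral_fourierIntegral_smul_eq_flip (L := innerₗ ℝ)
    (μ := volume) (ν := volume) Real.continuous_fourierChar continuous_inner hci hk
  simp only [flip_innerₗ, smul_eq_mul] at e2
  -- (3) assemble with `𝓕(conj h) = conj (𝓕⁻ h)`
  rw [e1]
  change ∫ ξ, starRingEnd ℂ (h ξ) * VectorFourier.fourierIntegral 𝐞 volume (innerₗ ℝ) k ξ =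
    ∫ x, starRingEnd ℂ (𝓕⁻ h x) * k x
  rw [← e2]
  refine integral_congr_ae (ae_of_all _ fun x ↦ ?_)
  simp only
  rw [← fourier_conj_eq_conj_fourierInv h x]
  rfl

end LatticeUncertainty.SlavedEL

end Summit.RiemannHypothesis.RiemannHypothesis.Theorems
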